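import Mathlib
import HarnessLib
import HarnessLib.Audit
import Summits.QuantumAdvantage.Statement
import Literature.Computability.QuantumComplexity.QSimSign
import Literature.Computability.Cryptography.FGComplexity
import Literature.Computability.Cryptography.FGProblemZoo
import Literature.Computability.Complexity.Promise
import HarnessLib.Audit.Status.Attr

/-!
Route: ExponentLadder

DORMANT since 2026-08-29T19:40:08Z (census g0: costume|duplicate of route-QuantumAdvantage-PromiseLift; reader census-reader-60-g0) — unstaffed, not closed; items shared with open routes are served there. `ledger route dormant <id> --off` reactivates.

# Route QuantumAdvantage/ExponentLadder — the dequantization exponent c* and its width ladder (card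
dequantization-exponent-ladder)

## Thesis X (WidthLadder)
Words: read circuit acceptance QSIM over the sign basis {H,Z,CZ,CCZ} (tree: `qSimSignProblem`,
PromiseBQP-complete, membership PROVED) as a
fine-grained problem on the word RAM (instance = code of an n-qubit circuit, size N = code length,
accepted answer [1]/[0] on the promise
A_Q >= 3/5 / |A_Q| <= 1/100, anything off the promise), and let QSIM_k be its restriction to ASPECT
RATIO k: n <= k*floor(log2 N) qubits.
The dequantization exponents are c*_k := inf{c : QSIM_k has a randomised O(N^c) word-RAM algorithm}
<= c* := the same for QSIM.
X := "for every exponent c there is an aspect ratio k such that QSIM_k has no randomised word-RAM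
algorithm running in time O(N^c)",
i.e. sup_k c*_k = infinity. It suffices: X -> c* = infinity -> (Frame: QSIM in PromiseBQP +
TM-to-RAM simulation) not (PromiseBQP ⊆ PromiseBPP')
-> (PL, the promise lift shared with route PromiseLift) QuantumAdvantage.
Lean (Q := the QSIM FGProblem literal ⟨QSimSignInstance, code bits as words, code length,
[1]/[0]/univ⟩):
`∀ c : ℕ, ∃ k : ℕ, ¬ (Q.restrict {I | I.n ≤ k * Nat.log 2 I.encode.length}).RandInTimeO (fun N => (N
: ℝ) ^ c)`

## Why an exponent, why the width index
c* = infinity is exactly X_PL of route PromiseLift in fine-grained clothing, but the index k makes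
every RUNG "c*_k >= g(k)" a statement
INSIDE P: c*_k <= k+2 provably (Schrodinger state-vector simulation with exact dyadic amplitudes;
Markov-Shi T^O(1) 2^O(treewidth)),
c*_k >= 1 trivially. No single rung implies the summit; only divergence does — the leverage SETH
itself has (SETH = a conjunction of k-SAT rungs).
The two known super-linear dequantization lower bounds ARE rungs: randomised SETH => c*_2 >= 2
(Grover for CNF-SAT compiled at aspect
ratio 2: n + O(k log n) qubits, 2^{n/2} poly gates, return amplitude = success probability by
compute-copy-uncompute), and
Kikuchi-optimality for planted noisy kXOR => c*_{k0} >= 4 (the quartic speedup of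
SchmidhuberEtAl2025 / Hastings2020 uses O(l log n)
qubits for classical time n^l; k0 = 4 x the space constant of the sparse-Hamiltonian
implementation). Both say "classical time >= 2^{(1-eps) qubits}"
at their aspect ratio: the conjectured LinearWidthLaw c*_k >= k, filed for refuters, whose truth for
all k is X with g(k) = k.

Rationale: WHY THIS LINE. Conditional NP-type hardness is useless for the summit at the exponential scale but
exactly right at the fine-grained
scale: randomised SETH already yields a decision-level quantum-advantage THEOREM (no T^{2-eps}
classical simulation of size-T circuits)
through Grover alone, with no HSP/cryptographic structure. The route imports the tree's word-RAM
fine-grained machinery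
(FGProblem/RandInTimeO, KSATInRAMTime-style Theta(n)-bit SETH, FGComplexity transfer) into the
quantum summit and organises the
evidence as ONE invariant: c*_k, the randomised word-RAM exponent of QSIM restricted to <= k log2(N)
qubits. Sources: Grover1996,
BoyerEtAl1998 (schedule), CalabroImpagliazzoPaturiIWPEC2009 + VassilevskaWilliamsICM2018 (randomised
SETH, word RAM),
AaronsonAmbainis2018 §6 (QSIM, Lemma 24; tree qSimSignProblem, membership proved),
SchmidhuberEtAl2025 / Hastings2020 (quartic,
O(l log n) qubits), KothariEtAl2017 (SoS evidence for the Kikuchi threshold), MarkovShi2008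
(ceiling), Goldreich2006/Watrous2009 (prBPP).
Cross-field import: fine-grained complexity (word-RAM reductions) -> quantum complexity at the
DECISION level; dictionary: rung k =
"classical time vs Hilbert-space dimension 2^q at q = k log2 T".

RANKED CRUXES. (2) SethRung: randomised word-RAM SETH (inlined; Theta(n)-bit words as KSATInRAMTime)
=> for all d>0, QSIM_2 has no
randomised O(N^{2-d}) algorithm [c*_2 >= 2]. Hardest genuinely provable item: a low-ancilla
Grover-SAT family over {H,Z,CZ,CCZ} + a word-RAM
instance writer + word-size emulation + amplification. (3) Frame: c* = infinity (no randomised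
poly-time word-RAM algorithm for QSIM) =>
not (PromiseBQP ⊆ PromiseBPP'); uses the PROVED membership
AaronsonAmbainis2018_lemma24_sign_mem_holds and a TM2 -> word-RAM interpreter
with coin-bit extraction (folklore, unbuilt). (4) KikuchiRung (informal until planted-kXOR/SOKB
definitions land): Kikuchi-optimality
=> c*_{k0} >= 4. (5) PlLift = PromiseLift's PL verbatim (shared item; open both ways).
SUPPORTS. LadderOfWidth (X => c* = infinity, restriction monotonicity); SchrodingerCeiling (QSIM_k
in deterministic O(N^{k+2}):
calibration, each rung lives in P); SethRungDet (tree's deterministic SETHWordRAM => no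
deterministic truly-sub-quadratic QSIM_2 algorithm:
the cheapest fileable conditional advantage theorem); LinearWidthLaw (conjecture c*_k >= k for all k
>= 1: k = 1 is a theorem (parity),
k = 2 is SethRung's conclusion, k = 4 the Kikuchi anchor up to the space constant; refuter-facing:
an explicit N^{k-d} simulator at any
k >= 3 is valuable negative knowledge and reshapes g).
ASSEMBLY. WidthLadder -> LadderOfWidth -> Frame -> PlLift -> QuantumAdvantage (checked: provable by
modus ponens + contraposition).

KILL CRITERIA. PL refuted (shared fate with PromiseLift: advantage confined to promises) -> close
refuted:PlLift. A uniform-in-k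
("FPT") dequantization theorem, exists c for all k QSIM_k in BPTIME[N^c] -> X refuted, close (the
theorem itself would be a landmark).
SethRung refuted AS TYPED (convention slip: floors, word size, unary wire codes) -> restate once;
refuted in substance (aspect ratio 2
unreachable) -> restate at unrestricted QSIM (c* >= 2), demote the width framing. LinearWidthLaw
refuted at some k >= 3 -> informative only.
Frame unprovable only by convention mismatch -> restate with the interpreter's actual overheads.

NOT DECOMPOSED YET (tenure, glued splits <= 3): SethRung = (quantum half: Grover family, amplitudes
exact over the sign basis, qubit and
size bounds) + (RAM half: instance writer, emulation, schedule r in {0,1,2^j}, majority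
amplification); Frame = (PromiseBPP' -> randomised
TM notion) + (TM2 -> word-RAM interpreter) + (promise/off-promise bookkeeping); KikuchiRung needs
defs (planted noisy kXOR ensemble,
Kikuchi-threshold hypothesis, SOKB Thm as named fact: requested); the converse QuantumAdvantage ->
c* = infinity (needs the named fact
AaronsonAmbainis2018_lemma24_sign_hard + a RAM -> TM bridge) is deliberately not filed; no
definition of c* as an sInf is filed (rungs are
stated as explicit time bounds, which is all any proof uses).

Novelty: NOVELTY (search-before-claim: the card's refuter audit 2026-08-15 read HuangNewmanSzegedy2020 =
arXiv:1804.10368 in full and ran crossref/hybrid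
queries; this session: lit frontier QuantumAdvantage --since 2021 (30 rows, none fine-grained), lit
vsearch paraphrase of the width law (textbook
hits only), lit galaxy --star pdf "strong quantum simulation" (1 hit: Bravyi et al. stabilizer rank)
and "classical simulation of quantum
circuits" (20 engineering hits), lit read arXiv:2406.19378 (SOKB, resource counts pp. 6, 22-23, 27)
and arXiv:1805.05224 (DHKL, Conj. 1-2,
word RAM p. 10); searchd/OpenAlex/S2/arXiv were 429/unavailable — refuter to rerun "fine-grained
weak simulation SETH Grover",
"QSETH", "qubits logarithmic quartic speedup exponent").
Nearest prior art: (1) HuangNewmanSzegedy2020 — SETH => 2^{n-o(n)} for STRONG (amplitude) simulation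
of n-qubit poly-size circuits and
unconditional bounds for monotone simulators; (2) MorimaeTamaki2019 (doi:10.26421/qic19.13-14-2:
SETH/NSETH-type conjectures => no 2^{(1-a)N}-time multiplicative-error SAMPLING of
N-qubit DQC1/HC1Q models, and ETH => no 2^{o(t)} sampling of Clifford+T circuits with t T-gates — a
resource-indexed bound with index =
T-count), MorimaeTamaki2020 (doi:10.22331/q-2020-09-24-329, additive error) and
Hayakawa-Morimae-Tamaki — all SAMPLING; (3) DalzellEtAl2020 (arXiv:1805.05224) — qubit counts for
supremacy from
poly3-NSETH(a)/per-int-NSETH(b), sampling, n qubits with poly(n) gates; (4) Buhrman-Patro-Speelman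
QSETH  [refs: 10.26421/qic19.13-14-2:, 10.22331/q-2020-09-24-329, 1804.10368, 2406.19378, 1805.05224, 1911.05686, doi:10.26421/qic19.13-14-2, doi:10.22331/q-2020-09-24-329, HuangNewmanSzegedy2020, MorimaeTamaki2019, MorimaeTamaki2020, DalzellEtAl2020, SchmidhuberEtAl2025, Hastings2020, AaronsonAmbainis2018, MarkovShi2008]

Barriers (technique_class: fine-grained-hypotheses, conditional-bridge, simulation): BARRIERS (technique_class: fine-grained-hypotheses, conditional-bridge, simulation).
- Literature.Barriers.QuantumAdvantage.SeparationPrerequisites: APPLIES to X (WidthLadder => c* =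
infinity => not (PromiseBQP ⊆ PromiseBPP') => with BQP ⊆ PP-type facts P ≠ PP, P ≠ PSPACE), NOT
evaded; no rung is blocked because every rung is either conditional (SethRung, KikuchiRung) or a
statement inside P (c*_k <= k+2, SchrodingerCeiling); the bet is the ladder organisation (divergence
of individually-polynomial rungs), not an unconditional proof of X.
- Literature.Barriers.QuantumAdvantage.Relativization: rungs are explicit white-box algorithms +
hypotheses about explicit problems and the Frame is a plain simulation argument, all relativizing
harmlessly (like Shor => summit from FACTORING); a proof of X itself inherits the need for
non-relativizing ideas exactly as the summit does; acknowledged, nothing claimed.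
- Literature.Barriers.QuantumAdvantage.Algebrization: as Relativization (AaronsonWigderson2008-type
oracles collapse promise classes too); silent on the conditional rungs.
- Literature.Barriers.QuantumAdvantage.TotalFunctionSpeedupLimit: INFORMATIVE, it is why rungs
sourced from unstructured classical problems stall at exponent 2 (D = O(Q^4), Grover-type search is
quadratic): rung 2 is Grover, rung 4 already needs planted structure (Kikuchi guiding states), and
no classical-problem anchor beyond 4 is known; the ladder's higher rungs must come from structured
white-box problems or

Novelty grade: new-combination — ROUTE REVIEW (refuter E-d83931e1-0, 2026-08-15; 3rd pass after c064b68f-0 / A-9bf55acc-0 — concur; details in item notes 2460–2467). new-combination: rung 2 = HNS20 arXiv:1804.10368 Thm 3's SAT→(n+O(log nm))-qubit reduction + Grover to a constant gap — a decision-level answer at aspect ratio 2 to th (refuter refuter-rreview-route-QuantumAdvantage-E-d83931e1-0, 2026-08-15T13:56:41Z; prior: arXiv:1804.10368 HNS20 Thm 3/Cor 11 + sec.5.2 open question (rung 2 = its reduction + Grover), Grover1996/BoyerEtAl1998 + CIP09/VVW-ICM18 Hyp.1 = tree SETHWordRAMRand, arXiv:2602.14379 CHLS26 Thm 1.2/Lemma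 4.2 (qubit-indexed SETH law, QMA level), doi:10.26421/qic19.13-14-2 MT19; doi:10.22331/q-2020-09-24-329 MT20; arXiv:1805.05224 DHKL20 (sampling), arXiv:2406.19378 SOKB25 / Hastings2020 (rung 4),)

History (route lifecycle, newest last):
- 2026-08-16T02:17:40Z · AUTO-CRUX: 2 conjecture-grade item(s) promoted to crux (LadderOfWidth, LinearWidthLaw) — refuter vetting / tiering apply (operator:999:1362873)
- 2026-08-16T04:14:57Z · AUTO-CRUX (backfill): WidthLadder — hypotheses of the deciding theorem that nothing in the route derives are cruxes (operator:999:1085951)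
- 2026-08-24T11:53:27Z · DORMANT — reconciler: no traction for 6.7 d (last activity item-evidence-added at 2026-08-17T17:20:32Z); parked, not closed — `ledger route dormant route-QuantumAdvantage (operator:999:3915185)
- 2026-08-29T10:34:53Z · REACTIVATED — reconciler: reactivated — activity statement-checked at 2026-08-29T09:00:29Z after parking at 2026-08-24T11:53:27Z (operator:999:2733033)
- 2026-08-29T19:40:08Z · DORMANT — census g0: costume|duplicate of route-QuantumAdvantage-PromiseLift; reader census-reader-60-g0 (operator:999:1603411)

sub-problem: QuantumAdvantage · status: dormant · opened planner-plancard-QuantumAdvantage-QuantumAdva-f7acbe8e-0 2026-08-15T11:04:19Z · rev 3 · ledger route-QuantumAdvantage-ExponentLadder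
GENERATED by the gate from the ledger (D-0016/17). Provers cite these decls: `theorem foo : Summit.QuantumAdvantage.QuantumAdvantage.Theses.ExponentLadder.<Decl> := …` in Summits/QuantumAdvantage/QuantumAdvantage/Theorems/<Name>.lean.
-/

namespace Summit.QuantumAdvantage.QuantumAdvantage.Theses.ExponentLadder

open scoped BigOperators Topology Manifold Classical MeasureTheory ProbabilityTheory Matrix InnerProductSpace ComplexConjugate ContinuousMap
open Filter Set Function TopologicalSpace MeasureTheory

attribute [summit_statement] _root_.QuantumAdvantage

open Literature.QuantumAdvantage

/-- item stmt-QuantumAdvantage-2460 · crux (kind.auto-crux: conjecture-grade) · rank 0 · open · by planner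
why it might fail: Hardness of QSIM could live only in WIDE circuits: a uniform-in-k ('FPT') simulation ∃c ∀k QSIM_k ∈ BPTIME[f(k)·N^c] refutes X while leaving c* = ∞ and the summit intact; no anchor beyond exponent 4 is known (TotalFunctionSpeedupLimit explains why unstructured sources stall at 2).
sources: AaronsonAmbainis2018 §6 Lemma 24 (QSIM PromiseBQP-complete; tree qSimSignProblem), MarkovShi2008 Thm 1.1 (T^{O(1)} 2^{O(tw)} ceiling), SchmidhuberEtAl2025 §1.3 (quartic, O(l log n) qubits), Literature.Barriers.QuantumAdvantage.TotalFunctionSpeedupLimit, Literature.Barriers.QuantumAdvantage.SeparationPrerequisites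
[target] Thesis X (WIDTH LADDER): for every exponent c there is an aspect ratio k such that QSIM
restricted to circuits with at most k·⌊log₂ N⌋ qubits (N = code length) has no randomised word-RAM
algorithm in time O(N^c) (success ≥ 2/3, Θ(log N)-bit words: FGProblem.RandInTimeO), i.e. sup_k c*_k
= ∞ for the dequantization exponents c*_k := inf{c : QSIM_k ∈ RandTIME_RAM[O(N^c)]}. Q = the QSIM
FGProblem literal ⟨QSimSignInstance, code bits as words (Bool.toNat), size = code length N, Good =
{[1]} if IsYes / {[0]} if IsNo / univ off the promise⟩; QSIM_k = Q.restrict {I | I.n ≤ k * Nat.log 2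
N} (aspect ratio k). Implies c* = ∞ (LadderOfWidth), hence X_PL of route PromiseLift (Frame), hence
the summit modulo PL. Conjecture-strength (implies P ≠ PSPACE-type separations via Frame); each RUNG
c*_k ≥ g(k) is a statement inside P (SchrodingerCeiling: c*_k ≤ k+2). [card
dequantization-exponent-ladder; AaronsonAmbainis2018 §6 (QSIM); VassilevskaWilliamsICM2018 §2 (word
RAM)] -/
@[route_item "route-QuantumAdvantage-ExponentLadder", crux]
def WidthLadder : Prop :=
  let Q : Literature.Computability.Cryptography.FGProblem := ⟨Literature.Computability.QuantumComplexity.QSimSignInstance, fun I => I.encode.map Bool.toNat, fun I => I.encode.length, fun I => if I.IsYes then {[1]} else if I.IsNo then {[0]} else Set.univ⟩; ∀ c : ℕ, ∃ k : ℕ, ¬ (Q.restrict {I | I.n ≤ k * Nat.log 2 I.encode.length}).RandInTimeO (fun N => (N : ℝ) ^ c)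

/-- item stmt-QuantumAdvantage-2461 · crux · rank 2 · open · by planner
why it might fail: Needs an O(k log n)-ancilla CNF oracle (counter trick) so Grover-SAT sits at aspect ratio 2 after padding, a schedule r∈{0,1,2^j} reaching A ≥ 3/5, word-size emulation of the QSIM decider, and RANDOMISED SETH (stronger than the tree's SETHWordRAM); any convention slip forces a restatement.
sources: Grover1996, BoyerEtAl1998 (tight bounds; iteration schedule), CalabroImpagliazzoPaturiIWPEC2009 §1 (s_k over randomised algorithms; SETH), VassilevskaWilliamsICM2018 §2-3 (word RAM, Hypothesis 1), AaronsonAmbainis2018 §6 Lemma 24 (QSIM; compute-uncompute normal form), Literature.Computability.FineGrained.SETHWordRAM and KSATInRAMTime (tree, SETHHardness.lean)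
[crux] RUNG 2 (c*_2 ≥ 2): randomised word-RAM SETH — for every ε>0 some k ≥ 3 such that k-SAT (tree
kSATProblem k: width ≤ k, no repeated clause, size n = numVars) has no oracle-free word-RAM program
with Θ(n)-bit words (w = k'(n + width), exactly as the tree's KSATInRAMTime) succeeding with
probability ≥ 2/3 within ⌊C·2^{(1-ε)n} + C⌋ steps (inlined; CIP09 define s_k over randomised
algorithms) — IMPLIES: for every δ>0, QSIM at aspect ratio 2 has no randomised O(N^{2-δ}) word-RAM
algorithm. Proof plan: given φ (n vars, m ≤ (2n)^k clauses) and r, the sign-basis circuit V_r =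
(U_r† ⊗ 1)·C_φ·(U_r ⊗ 1)·(1 ⊗ X) with U_r = r Grover iterations over n+2 search bits (two spare bits
keep θ ≤ 30°) has return amplitude A = success probability p_r exactly (real, ≥ 0), so unsat ⇒ A = 0
(NO) and sat ⇒ some r ∈ {0,1} ∪ {2^j : j ≤ n/2+O(1)} has A ≥ 3/5 (YES); C_φ via a ⌈log₂(m+1)⌉-bit
counter so the circuit has n + O(k log n) qubits and 2^{n/2}·poly(n,m) gates; pad with identity
pairs until n_qubits ≤ 2⌊log₂ N⌋ (costs poly factors); a RAM with Θ(n)-bit words writes each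
instance in Õ(N) steps, runs the assumed QSIM_2 decider (word-size emulation by masking, O(log
n)-fold majority), total 2^{(1-δ/2) -/
@[route_item "route-QuantumAdvantage-ExponentLadder"]
def SethRung : Prop :=
  let Q : Literature.Computability.Cryptography.FGProblem := ⟨Literature.Computability.QuantumComplexity.QSimSignInstance, fun I => I.encode.map Bool.toNat, fun I => I.encode.length, fun I => if I.IsYes then {[1]} else if I.IsNo then {[0]} else Set.univ⟩; (∀ ε : ℝ, 0 < ε → ∃ k : ℕ, 3 ≤ k ∧ ¬ ∃ (M : Literature.Computability.Cryptography.WordRAM.Program) (k' : ℕ) (C : ℝ), M.IsOracleFree ∧ ∀ φ : (Literature.Computability.Cryptography.kSATProblem k).Inst, (2 / 3 : ℝ) ≤ Literature.Computability.Cryptography.WordRAM.successProb M (k' * ((Literature.Computability.Cryptography.kSATProblem k).size φ + (Literature.Computability.Cryptography.kSATProblem k).width φ)) Literature.Computability.Cryptography.WordRAM.noOracle ((Literature.Computability.Cryptography.kSATProblem k).encode φ) ((Literature.Computability.Cryptography.kSATProblem k).Good φ) ⌊C * (2 : ℝ) ^ ((1 - ε) * ((Literature.Computability.Cryptography.kSATProblem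 k).size φ : ℝ)) + C⌋₊) → ∀ δ : ℝ, 0 < δ → ¬ (Q.restrict {I | I.n ≤ 2 * Nat.log 2 I.encode.length}).RandInTimeO (fun N => (N : ℝ) ^ ((2 : ℝ) - δ))

/-- item stmt-QuantumAdvantage-2462 · crux · rank 3 · open · by planner
why it might fail: Folklore mathematically, but the TM2→word-RAM interpreter with coin-bit extraction is unbuilt (cf. undischarged kSATInRAMTime_of_kSATInExpTime); convention mismatches (coin length p(|x|) vs coin words, ⌊C·t+C⌋ floors, off-promise halting, input width) could force restating.
sources: CookReckhow1973 §2 (RAM/TM simulations), VassilevskaWilliamsICM2018 §2 (word RAM conventions), Goldreich2006 Def 1.2 (promise-BPP), Watrous2009 §III.2 (PromiseBQP), Literature.Computability.QuantumComplexity.AaronsonAmbainis2018_lemma24_sign_mem_holds (tree, QSimSignProofs.lean), Literature.Computability.FineGrained.kSATInRAMTime_of_kSATInExpTime (tree, named folklore fact of the same kind)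
[crux] FRAME (c* = ∞ ⇒ X_PL): if QSIM (as the FGProblem Q) has no randomised polynomial-time
word-RAM algorithm (∀c, ¬ Q.RandInTimeO N^c), then ¬(PromiseBQP ⊆ PromiseBPP'). Proof plan:
qSimSignProblem ∈ PromiseBQP is PROVED in the tree (AaronsonAmbainis2018_lemma24_sign_mem_holds); if
PromiseBQP ⊆ PromiseBPP' take L' ∈ P and the coin polynomial p from PromiseBPP'; a word-RAM program
reads the code bits, draws p(|x|) coin bits (low bits of rand words), forms boolPair x y and runs a
word-RAM simulation of the TM2 deciding L' (multi-stack machine: stacks as memory segments with top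
pointers, O(1) RAM steps per TM step, pointers fit in Θ(log N)-bit words); on promise instances it
is correct with probability ≥ 2/3, off the promise Good = univ and it halts within the bound anyway
— so Q.RandInTimeO(N^c) for some c, contradiction. Q = the QSIM FGProblem literal ⟨QSimSignInstance,
code bits as words (Bool.toNat), size = code length N, Good = {[1]} if IsYes / {[0]} if IsNo / univ
off the promise⟩; QSIM_k = Q.restrict {I | I.n ≤ k * Nat.log 2 N} (aspect ratio k). [Goldreich2006
Def 1.2; Watrous2009 §III.2; CookReckhow1973 §2; VassilevskaWilliamsICM2018 §2] -/
@[route_item "route-QuantumAdvantage-ExponentLadder", crux]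
def Frame : Prop :=
  let Q : Literature.Computability.Cryptography.FGProblem := ⟨Literature.Computability.QuantumComplexity.QSimSignInstance, fun I => I.encode.map Bool.toNat, fun I => I.encode.length, fun I => if I.IsYes then {[1]} else if I.IsNo then {[0]} else Set.univ⟩; (∀ c : ℕ, ¬ Q.RandInTimeO (fun N => (N : ℝ) ^ c)) → ¬ (Literature.Computability.Cryptography.PromiseBQP ⊆ Literature.Computability.Complexity.PromiseBPP')

-- item stmt-QuantumAdvantage-2597 · crux · rank 4 · open · by planner — informal only, no Lean statement yet:
--   [crux] RUNG 4 (c*_{k₀} ≥ 4α), INFORMAL until definitions land. Let P^z_{n,k}(m,ρ) / R_{n,k}(m) be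
--   the planted-noisy resp. uniformly random kXOR ensembles (n variables, m constraints, planted
--   advantage ρ; SchmidhuberEtAl2025 §2), Δ_ℓ the constraint density at which the level-ℓ Kikuchi method
--   distinguishes them in time Õ(n^ℓ) ('Alice theorem', SchmidhuberEtAl2025 Thm 2.x / §2.4; WAM19;
--   Hastings2020), and KH(α) the KIKUCHI-THRESHOLD HYPOTHESIS: for every ε>0 and all large ℓ, no
--   randomised word-RAM algorithm distinguishes P^z from R at density Δ_ℓ with advantage ≥ 1/3 in time
--   O(n^{(α-ε)ℓ}) (eviden

/-- item stmt-QuantumAdvantage-0250 · crux · rank 5 · open · by planner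
why it might fail: False iff BQP ⊆ BPP while PromiseBQP ⊄ prBPP (advantage confined to promises); not excluded: the classical lift BPP = P ⇒ prBPP = prP is OPEN (Goldreich2011 §6), the query shadow of ¬PL holds (D ≤ O(Q^4) vs exponential promise gaps), no BQP-complete language is known.
sources: Goldreich2011 = doi:10.1007/978-3-642-22670-0_20 §6 (open problem, fn 27), AaronsonArkhipov2013 = doi:10.4086/toc.2013.v009a004 §10 open problems (9)-(10), Literature.Barriers.QuantumAdvantage.TotalFunctionSpeedupLimit (query shadow of ¬PL), route-QuantumAdvantage-PromiseLift item stmt-QuantumAdvantage-0250 (same statement)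
OPEN structural question (analogue of 'P = BPP ⇒ prP = prBPP?', Goldreich2011 §1): does equality of
the language classes force equality of the textbook promise classes? The obstruction: a PromiseBQP
family has no acceptance gap off the promise, so its threshold set is not a BQP language. Most
informative crux of the route: a proof makes every PromiseBQP-completeness result (Jones,
Forrelation) a bona fide reformulation of BQP ≠ BPP; a relativized counterexample would explain why
decision-level quantum advantage evidence is scarce. [Goldreich2006 §1.2; Goldreich2011; Watrous2009
§III.2] -/
@[route_item "route-QuantumAdvantage-ExponentLadder", crux]
def PlLift : Prop :=
  Literature.Computability.Cryptography.BQP ⊆ Literature.Computability.Complexity.BPP → Literature.Computability.Cryptography.PromiseBQP ⊆ Literature.Computability.Complexity.PromiseBPP'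

/-- item stmt-QuantumAdvantage-2463 · crux (kind.auto-crux: conjecture-grade) · rank 9 · open · by planner
why it might fail: auto-crux — conjecture-grade statement (docstring avows it ('Conjectures')); it is open, so it may simply be false
sources: conjecture-registry
[support] Glue X ⇒ c* = ∞: if for every c some aspect-ratio restriction QSIM_k has no randomised
O(N^c) algorithm then QSIM itself has none (an algorithm for Q restricts to every Q.restrict S:
`randInTimeO_restrict_anti`-style monotonicity, Conjectures.lean; here from the unrestricted problem
to a restriction, one line). Q = the QSIM FGProblem literal ⟨QSimSignInstance, code bits as words
(Bool.toNat), size = code length N, Good = {[1]} if IsYes / {[0]} if IsNo / univ off the promise⟩;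
QSIM_k = Q.restrict {I | I.n ≤ k * Nat.log 2 N} (aspect ratio k). [folklore] -/
@[route_item "route-QuantumAdvantage-ExponentLadder", crux]
def LadderOfWidth : Prop :=
  let Q : Literature.Computability.Cryptography.FGProblem := ⟨Literature.Computability.QuantumComplexity.QSimSignInstance, fun I => I.encode.map Bool.toNat, fun I => I.encode.length, fun I => if I.IsYes then {[1]} else if I.IsNo then {[0]} else Set.univ⟩; (∀ c : ℕ, ∃ k : ℕ, ¬ (Q.restrict {I | I.n ≤ k * Nat.log 2 I.encode.length}).RandInTimeO (fun N => (N : ℝ) ^ c)) → ∀ c : ℕ, ¬ Q.RandInTimeO (fun N => (N : ℝ) ^ c)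

/-- item stmt-QuantumAdvantage-2466 · crux (kind.auto-crux: conjecture-grade) · rank 9 · open · by planner
why it might fail: auto-crux — conjecture-grade statement (docstring avows it ('CONJECTURE')); it is open, so it may simply be false
sources: conjecture-registry
[support] CONJECTURE (refuter-facing; the proposed divergent family with g(k) = k): for every k ≥ 1
and ε > 0, QSIM at aspect ratio k has no randomised O(N^{k-ε}) word-RAM algorithm, i.e. c*_k ≥ k:
'deciding a quantum computation costs classically the Hilbert-space dimension 2^q = N^k at every
aspect ratio'. Status by k: k = 1 is a THEOREM (parity of the number of Z gates among N slots on one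
Hadamard-conjugated qubit needs Ω(N) probes even randomised); k = 2 is SethRung's conclusion under
randomised SETH (Grover-SAT saturates it: classical 2^n = T^2 = 2^q); k = 4 is the Kikuchi/SOKB
anchor up to the space constant of sparse Hamiltonian simulation (classical n^ℓ = T^4); k ≥ 3
otherwise has NO anchor and sits just below the ceilings N^{k+2} (SchrodingerCeiling) / N^{O(k)}
(Markov-Shi). LinearWidthLaw ⇒ WidthLadder (take k = c+1). A refutation at any k ≥ 3 (an explicit
N^{k-ε} simulator for k·log₂N-qubit circuits) is valuable negative knowledge and reshapes g; it does
not touch X. Q = the QSIM FGProblem literal ⟨QSimSignInstance, code bits as words (Bool.toNat), size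
= code length N, Good = {[1]} if IsYes / {[0]} if IsNo / univ off the promise⟩; QSIM_k = Q.restrict
{I | I.n ≤ k * Nat -/
@[route_item "route-QuantumAdvantage-ExponentLadder"]
def LinearWidthLaw : Prop :=
  let Q : Literature.Computability.Cryptography.FGProblem := ⟨Literature.Computability.QuantumComplexity.QSimSignInstance, fun I => I.encode.map Bool.toNat, fun I => I.encode.length, fun I => if I.IsYes then {[1]} else if I.IsNo then {[0]} else Set.univ⟩; ∀ k : ℕ, 1 ≤ k → ∀ ε : ℝ, 0 < ε → ¬ (Q.restrict {I | I.n ≤ k * Nat.log 2 I.encode.length}).RandInTimeO (fun N => (N : ℝ) ^ ((k : ℝ) - ε))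

/-- item stmt-QuantumAdvantage-2464 · support · rank 9 · open · by planner
[support] CEILING c*_k ≤ k+2 (calibration: every rung is a statement inside P): for every k, QSIM at
aspect ratio k is decided DETERMINISTICALLY on the word RAM in time O(N^{k+2}). Proof plan:
Schrödinger state-vector simulation with EXACT dyadic amplitudes — over {H,Z,CZ,CCZ} the state after
the gates read so far is 2^{-h/2}·Σ_x z_x|x⟩ with z_x ∈ ℤ, |z_x| ≤ 2^{h/2}, h = #Hadamards ≤ N, so
each z_x is a bignum of O(N/log N) words; a diagonal gate flips signs, a Hadamard maps (z_{x0},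
z_{x1}) ↦ (z_{x0}+z_{x1}, z_{x0}-z_{x1}) on 2^{q-1} pairs: O(2^q·N/log N) word operations per gate,
2^q ≤ N^k amplitudes (word size k'·inputWidth with k' ≥ k+2 addresses them), N gates: O(N^{k+2});
finally compare 25·z_0² with 9·2^h (YES iff A = z_0/2^{h/2} ≥ 3/5; output [0] otherwise, which is
accepted on NO and off-promise instances); oracle-gate instances are detected syntactically and
answered [0]. Exponent k+1 would need rounding analysis (O(log N)-bit floating point) and is NOT
claimed. Q = the QSIM FGProblem literal ⟨QSimSignInstance, code bits as words (Bool.toNat), size =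
code length N, Good = {[1]} if IsYes / {[0]} if IsNo / univ off the promise⟩; QSIM_k = Q.restrict {I
| I.n ≤ k * Nat.log 2 -/
@[route_item "route-QuantumAdvantage-ExponentLadder"]
def SchrodingerCeiling : Prop :=
  let Q : Literature.Computability.Cryptography.FGProblem := ⟨Literature.Computability.QuantumComplexity.QSimSignInstance, fun I => I.encode.map Bool.toNat, fun I => I.encode.length, fun I => if I.IsYes then {[1]} else if I.IsNo then {[0]} else Set.univ⟩; ∀ k : ℕ, (Q.restrict {I | I.n ≤ k * Nat.log 2 I.encode.length}).InTimeO (fun N => (N : ℝ) ^ (k + 2))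

/-- item stmt-QuantumAdvantage-2465 · support · rank 9 · open · by planner
[support] Deterministic RUNG 2 from the tree's hypothesis verbatim: SETHWordRAM
(Literature.Computability.FineGrained.SETHWordRAM, deterministic Θ(n)-bit-word SETH, VVW ICM 2018
Hypothesis 1) ⇒ QSIM at aspect ratio 2 has no DETERMINISTIC truly-subquadratic word-RAM algorithm (¬
TrulySubTime 2, i.e. no O(N^{2-ε}) for any ε>0). Same Grover instance map as SethRung without coins
or amplification; the cheapest fileable conditional quantum-advantage theorem of the route
(deterministic dequantization exponent ≥ 2). Q = the QSIM FGProblem literal ⟨QSimSignInstance, code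
bits as words (Bool.toNat), size = code length N, Good = {[1]} if IsYes / {[0]} if IsNo / univ off
the promise⟩; QSIM_k = Q.restrict {I | I.n ≤ k * Nat.log 2 N} (aspect ratio k). [Grover1996;
BoyerEtAl1998; WilliamsTCS2005 §5 (shape of SETH reductions); VassilevskaWilliamsICM2018 §3] -/
@[route_item "route-QuantumAdvantage-ExponentLadder"]
def SethRungDet : Prop :=
  let Q : Literature.Computability.Cryptography.FGProblem := ⟨Literature.Computability.QuantumComplexity.QSimSignInstance, fun I => I.encode.map Bool.toNat, fun I => I.encode.length, fun I => if I.IsYes then {[1]} else if I.IsNo then {[0]} else Set.univ⟩; (∀ ε : ℝ, 0 < ε → ∃ k : ℕ, 3 ≤ k ∧ ¬ ∃ (M : Literature.Computability.Cryptography.WordRAM.Program) (k' : ℕ) (C : ℝ), M.IsDeterministic ∧ M.IsOracleFree ∧ ∀ φ : (Literature.Computability.Cryptography.kSATProblem k).Inst, ∃ out ∈ (Literature.Computability.Cryptography.kSATProblem k).Good φ, Literature.Computability.Cryptography.WordRAM.OutputsWithin M (k' * ((Literature.Computability.Cryptography.kSATProblem k).size φ + (Literature.Computability.Cryptography.kSATProblem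 k).width φ)) Literature.Computability.Cryptography.WordRAM.noOracle Literature.Computability.Cryptography.WordRAM.zeroCoins ((Literature.Computability.Cryptography.kSATProblem k).encode φ) out ⌊C * (2 : ℝ) ^ ((1 - ε) * ((Literature.Computability.Cryptography.kSATProblem k).size φ : ℝ)) + C⌋₊) → ¬ (Q.restrict {I | I.n ≤ 2 * Nat.log 2 I.encode.length}).TrulySubTime 2

/-- item stmt-QuantumAdvantage-2467 · assembly · rank 1 · open · by planner
[assembly] WidthLadder → LadderOfWidth → Frame → PlLift → QuantumAdvantage: X gives c* = ∞
(LadderOfWidth), Frame gives ¬(PromiseBQP ⊆ PromiseBPP'), PL contraposed gives ¬(BQP ⊆ BPP), and a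
language in BQP ∖ BPP is the summit `∃ L, L ∈ BQP ∧ L ∉ BPP` (by_contra on the subset). Checked
provable in the planner's sketch (8 tactic lines). -/
@[route_item "route-QuantumAdvantage-ExponentLadder"]
def Assembly : Prop :=
  WidthLadder → LadderOfWidth → Frame → PlLift → QuantumAdvantage

/-! D-0027 §2.1 — DECIDING THEOREM (planner-authored via `route open/edit --closes-file`; by planner-rbadge-QuantumAdvantage-ExponentLadder-ab2a0d6f-g4-0 2026-08-15T16:13:11Z):
its hypotheses are this route's items and its conclusion the sub-problem Statement (glue_lint), and it elaborates with this file. -/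

/-- DECIDING THEOREM (D-0027 §2.1) of route ExponentLadder: the width ladder X (`WidthLadder`)
gives `c* = ∞` for QSIM over the sign basis (`LadderOfWidth`), the frame turns that into
`¬ (PromiseBQP ⊆ PromiseBPP')` (`Frame`), the promise lift `PlLift` contraposed gives
`¬ (BQP ⊆ BPP)`, and a language in `BQP \ BPP` is the summit `∃ L, L ∈ BQP ∧ L ∉ BPP`. -/
@[closes "route-QuantumAdvantage-ExponentLadder"] theorem closes (hX : WidthLadder) (hL : LadderOfWidth) (hF : Frame) (hP : PlLift) :
    QuantumAdvantage := by
  have h1 : ¬ (Literature.Computability.Cryptography.PromiseBQP ⊆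
      Literature.Computability.Complexity.PromiseBPP') := hF (hL hX)
  have h2 : ¬ (Literature.Computability.Cryptography.BQP ⊆
      Literature.Computability.Complexity.BPP) := fun h => h1 (hP h)
  obtain ⟨L, hLQ, hLP⟩ := Set.not_subset.mp h2
  exact ⟨L, hLQ, hLP⟩

end Summit.QuantumAdvantage.QuantumAdvantage.Theses.ExponentLadder
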